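import Mathlib.Analysis.Convex.SpecificFunctions.Basic
import Mathlib.Analysis.SpecialFunctions.Trigonometric.Series
import Mathlib.Algebra.BigOperators.Field
import HarnessLib

/-!
# Hoeffding's inequality on finite product spaces, counting form

Hoeffding's lemma and Hoeffding's inequality (Hoeffding 1963, Thm. 2) in the measure-free counting
form used by combinatorial sampling arguments: for mean-zero `f_i : κ_i → ℝ` with `|f_i| ≤ c_i`,

  `#{y ∈ ∏_i κ_i : ∑_i f_i(y_i) ≥ t} ≤ exp(-t² / (2 ∑_i c_i²)) · ∏_i #κ_i`.

This is the canonical home of the statement for the complexity-theoretic files (sampling a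
majority vote, Impagliazzo's hard-core lemma, Goldreich–Nisan–Wigderson's XOR-lemma survey,
Claim 4.2): the proofs are those of `Literature/NumberTheory/LFunctions/TaoLogElliottHoeffding.lean`
(`Tao2016.exp_mul_le_chord`, `hoeffding_lemma_sum`, `hoeffding_count_pi`), whose import closure
(the circle method) makes it unusable as a dependency there; a librarian pass should retire those
copies onto this file.

## References

* W. Hoeffding, *Probability inequalities for sums of bounded random variables*, J. Amer. Statist.
  Assoc. 58 (1963) 13–30, Thm. 2.
-/

noncomputable section

open Finset Real

namespace Literature.Probability.Moments

/-- The chord bound for the exponential on `[-c, c]`: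
`exp(λu) ≤ ((c - u) exp(-λc) + (c + u) exp(λc)) / (2c)` for `|u| ≤ c`, `c > 0`. [folklore] -/
theorem exp_mul_le_chord {c u : ℝ} (hc : 0 < c) (hu : |u| ≤ c) (l : ℝ) :
    Real.exp (l * u) ≤ ((c - u) * Real.exp (-(l * c)) + (c + u) * Real.exp (l * c)) / (2 * c) := by
  have h1 : -c ≤ u := by linarith [abs_le.1 hu |>.1]
  have h2 : u ≤ c := (abs_le.1 hu).2
  set θ : ℝ := (c - u) / (2 * c) with hθ
  have hθ0 : 0 ≤ θ := by positivity
  have hθ1 : θ ≤ 1 := by rw [hθ, div_le_one (by positivity)]; linarith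
  have hconv := (convexOn_exp).2 (Set.mem_univ (-(l * c))) (Set.mem_univ (l * c)) hθ0
    (by linarith : 0 ≤ 1 - θ) (by ring : θ + (1 - θ) = 1)
  simp only [smul_eq_mul] at hconv
  have harg : θ * -(l * c) + (1 - θ) * (l * c) = l * u := by
    rw [hθ]; field_simp; ring
  rw [harg] at hconv
  refine hconv.trans (le_of_eq ?_)
  rw [hθ]; field_simp; ring

/-- **Hoeffding's lemma**, finite uniform form: if `f` has mean zero on the finite set `A` and
`|f| ≤ c` on `A`, then `∑_{a ∈ A} exp(λ f(a)) ≤ #A · exp(λ² c² / 2)`. [folklore] -/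
theorem hoeffding_lemma_sum {α : Type*} (A : Finset α) (f : α → ℝ) {c : ℝ}
    (hf0 : ∑ a ∈ A, f a = 0) (hfc : ∀ a ∈ A, |f a| ≤ c) (l : ℝ) :
    ∑ a ∈ A, Real.exp (l * f a) ≤ A.card * Real.exp (l ^ 2 * c ^ 2 / 2) := by
  rcases A.eq_empty_or_nonempty with rfl | hA
  · simp
  obtain ⟨a₀, ha₀⟩ := hA
  have hc0 : 0 ≤ c := (abs_nonneg _).trans (hfc a₀ ha₀)
  rcases hc0.eq_or_lt with rfl | hc
  · -- `c = 0`: `f = 0` on `A`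
    have hf : ∀ a ∈ A, f a = 0 := fun a ha => abs_nonpos_iff.1 (hfc a ha)
    calc ∑ a ∈ A, Real.exp (l * f a) = ∑ a ∈ A, (1 : ℝ) :=
          sum_congr rfl fun a ha => by rw [hf a ha, mul_zero, Real.exp_zero]
      _ ≤ A.card * Real.exp (l ^ 2 * 0 ^ 2 / 2) := by simp
  calc ∑ a ∈ A, Real.exp (l * f a)
      ≤ ∑ a ∈ A, ((c - f a) * Real.exp (-(l * c)) + (c + f a) * Real.exp (l * c)) / (2 * c) :=
        sum_le_sum fun a ha => exp_mul_le_chord hc (hfc a ha) l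
    _ = A.card * ((Real.exp (-(l * c)) + Real.exp (l * c)) / 2) +
          (∑ a ∈ A, f a) * ((Real.exp (l * c) - Real.exp (-(l * c))) / (2 * c)) := by
        rw [← sum_div, sum_add_distrib, ← sum_mul, ← sum_mul, sum_sub_distrib, sum_add_distrib,
          sum_const, nsmul_eq_mul]
        field_simp
        ring
    _ = A.card * Real.cosh (l * c) := by rw [hf0, zero_mul, add_zero, Real.cosh_eq]; ring_nf
    _ ≤ A.card * Real.exp (l ^ 2 * c ^ 2 / 2) := by
        gcongr
        calc Real.cosh (l * c) ≤ Real.exp ((l * c) ^ 2 / 2) := Real.cosh_le_exp_half_sq _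
          _ = Real.exp (l ^ 2 * c ^ 2 / 2) := by ring_nf

/-- **Hoeffding's inequality**, counting form on a finite product space (one-sided): for
mean-zero `f_i : κ_i → ℝ` with `|f_i| ≤ c_i`, and `t ≥ 0`,
`#{y : ∑_i f_i(y_i) ≥ t} ≤ exp(-t² / (2 ∑_i c_i²)) · ∏_i #κ_i`. [folklore] -/
theorem hoeffding_count_pi {ι : Type*} [Fintype ι] [DecidableEq ι] {κ : ι → Type*}
    [∀ i, Fintype (κ i)] [∀ i, DecidableEq (κ i)]
    (f : ∀ i, κ i → ℝ) (c : ι → ℝ) (hf0 : ∀ i, ∑ a, f i a = 0)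
    (hfc : ∀ i a, |f i a| ≤ c i) {t : ℝ} (ht : 0 ≤ t) (hS : 0 < ∑ i, c i ^ 2) :
    ((Finset.univ.filter fun y : (∀ i, κ i) => t ≤ ∑ i, f i (y i)).card : ℝ) ≤
      Real.exp (-(t ^ 2 / (2 * ∑ i, c i ^ 2))) * ∏ i, (Fintype.card (κ i) : ℝ) := by
  set S : ℝ := ∑ i, c i ^ 2 with hSdef
  set l : ℝ := t / S with hl
  have hl0 : 0 ≤ l := by positivity
  set E := Finset.univ.filter fun y : (∀ i, κ i) => t ≤ ∑ i, f i (y i) with hE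
  -- `#E · exp(λ t) ≤ ∑_y exp(λ ∑ f) = ∏_i ∑_a exp(λ f_i a) ≤ (∏ #κ_i) exp(λ² S / 2)`
  have h1 : (E.card : ℝ) * Real.exp (l * t) ≤
      ∑ y : (∀ i, κ i), Real.exp (l * ∑ i, f i (y i)) := by
    rw [← nsmul_eq_mul, ← sum_const]
    refine (sum_le_sum fun y hy => ?_).trans
      (sum_le_sum_of_subset_of_nonneg (filter_subset _ _) fun y _ _ => (Real.exp_pos _).le)
    rw [hE, mem_filter] at hy
    exact Real.exp_le_exp.2 (mul_le_mul_of_nonneg_left hy.2 hl0)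
  have h2 : ∑ y : (∀ i, κ i), Real.exp (l * ∑ i, f i (y i)) =
      ∏ i, ∑ a : κ i, Real.exp (l * f i a) := by
    simp_rw [mul_sum, Real.exp_sum]
    exact (prod_univ_sum (fun _ => Finset.univ) fun i a => Real.exp (l * f i a)).symm
  have h3 : ∏ i, ∑ a : κ i, Real.exp (l * f i a) ≤
      ∏ i, ((Fintype.card (κ i) : ℝ) * Real.exp (l ^ 2 * c i ^ 2 / 2)) := by
    refine prod_le_prod (fun i _ => sum_nonneg fun a _ => (Real.exp_pos _).le) fun i _ => ?_
    have := hoeffding_lemma_sum (Finset.univ : Finset (κ i)) (f i) (hf0 i)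
      (fun a _ => hfc i a) l
    simpa using this
  have h4 : ∏ i, ((Fintype.card (κ i) : ℝ) * Real.exp (l ^ 2 * c i ^ 2 / 2)) =
      (∏ i, (Fintype.card (κ i) : ℝ)) * Real.exp (l ^ 2 * S / 2) := by
    rw [prod_mul_distrib, ← Real.exp_sum, hSdef, mul_sum, sum_div]
  have h5 : (E.card : ℝ) * Real.exp (l * t) ≤
      (∏ i, (Fintype.card (κ i) : ℝ)) * Real.exp (l ^ 2 * S / 2) := by
    calc _ ≤ _ := h1
      _ = _ := h2
      _ ≤ _ := h3
      _ = _ := h4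
  -- divide by `exp(λ t)` and simplify the exponent
  have h6 : (E.card : ℝ) ≤ (∏ i, (Fintype.card (κ i) : ℝ)) * Real.exp (l ^ 2 * S / 2 - l * t) := by
    rw [Real.exp_sub, mul_div_assoc']
    rw [le_div_iff₀ (Real.exp_pos _)]
    exact h5
  have h7 : l ^ 2 * S / 2 - l * t = -(t ^ 2 / (2 * S)) := by
    rw [hl]; field_simp; ring
  rw [h7] at h6
  linarith [h6]


end Literature.Probability.Moments

end
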